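import Literature.Probability.Percolation.KSTPeriodicArms

/-!
# Stub `kstArms` of line `finite-size-envelope`, crux `CriticalPathRSW` (stmt-CriticalPhenomena-10267)

Lemma 1(ii) of [KohlerSchindlerTassion2023] in weak periodic (constant) form,
`KSTPeriodic.ArmsOfShortCrossings k t`: for `kℤ² ⋊ D₄`-periodic, positively associated measures
carried by lattice configurations, uniformly likely short-way crossings `𝓒_t(N, 8N)` (scales
`N ≥ N₀` divisible by `k`) force uniformly likely arm events `arm t (n/64) n` (scales `n ≥ N₁`
divisible by `64k`), granted the planar facts `ArchesMeet`, `PartsToSegmentsMeet` and `ArmDuality`.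

This file is a wrapper: the mathematics is the Literature theorem
`Literature.Probability.Percolation.KSTPeriodic.armsOfShortCrossings_of`
(`Literature/Probability/Percolation/KSTPeriodicArms.lean`): the dual measure `μ ∘ dualConfig⁻¹`
is admissible with parity offset `t + 1` (`KSTPeriodicDualMeasure.lean`); outside the arm event the
dual configuration has a bridge variant (`KSTPeriodicDualTransfer.lean`, from `ArmDuality`); in the
high regime the square-root trick and the gluing of [KohlerSchindlerTassion2023, §3]
(`KSTPeriodicBridges*.lean`) turn a very likely dual bridge variant into a very likely dual long
crossing, which a short-way primal crossing excludes (`ArmDuality` again) — contradicting the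
hypothesis at the scale `N = n + k`.
-/

namespace Summit.CriticalPhenomena.CardyFormulaZ2.Cruxes.CriticalPathRSW.FiniteSizeEnvelope

open Set MeasureTheory Filter Topology
open Literature.Probability.LatticeModels Literature.Probability.Percolation

/-- **Stub `stub_kstArms`**: Lemma 1(ii) of [KohlerSchindlerTassion2023] (with Comment 1) in weak
periodic form — short crossings give arms — from the planar inputs `ArchesMeet`,
`PartsToSegmentsMeet`, `ArmDuality`; the Literature theorem `KSTPeriodic.armsOfShortCrossings_of`. -/
theorem stub_kstArms :
  ∀ k t : ℕ, 1 ≤ k → KSTPeriodic.ArchesMeet → KSTPeriodic.PartsToSegmentsMeet → KSTPeriodic.ArmDuality →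
    KSTPeriodic.ArmsOfShortCrossings k t :=
  fun _ _ hk hAr hPS hDu => KSTPeriodic.armsOfShortCrossings_of hk hAr hPS hDu

end Summit.CriticalPhenomena.CardyFormulaZ2.Cruxes.CriticalPathRSW.FiniteSizeEnvelope
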